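import Literature.MathematicalPhysics.QuantumLattice.HubbardGroundStateKineticExcess
import Summits.HubbardSuperconductivity.HubbardSuperconductivity.Theorems.SoloBlindDiamondFermiSea
import HarnessLib

/-!
# Requirement R9 discharged at weak coupling: no nearly saturated ferromagnetism for `U < U₀(δ)`

Solo-blind residency `solo-HubbardSuperconductivity-blind`, session 7, Theorem 15 (part 3 of 3).
Theorem 14 (`SpinPolarization.summit_excludes_near_saturated_ferromagnetism`) showed that the
summit statement forces every ground multiplet of the `(N = 2m, S^z = 0)` sector,
`m = ⌊(1-δ)L²/2⌋`, to have total spin `S ≤ m - cL²/32` (requirement R9).  Here R9 is proved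
outright in an explicit weak-coupling window, by a Stoner-type variational argument:
`fermiSum_add_fermiSum_le_re_expect` (bathtub for both spins on Lieb's sector `(a, b)`, `⟨D⟩ ≥ 0`),
`minEnergyOn_szSector_le_pairedFermiSea` (`E₀(U; 2m, S^z=0) ≤ 2 Σ_{F_m} ε + U m²/L²`),
`minority_lower_bound` (**Theorem 15a**, every `L ≥ 3`: for `ψ ≠ 0` in the sector `(m + S, m - S)`
with `H(U)ψ = E₀(U; 2m, S^z = 0)ψ` and every admissible diamond size `K`,
`(16L²/π²) sin²(Kπ/L)(L² - m)/(L² - (2K²+2K+1)) - 4(L² - 2m) - U m²/L² ≤ 8(m - S)`), and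
`weakCoupling_excludes_near_saturated_ferromagnetism` (**Theorem 15**: for `0 < δ < 1`, `κ ∈ ℝ`,
`U ≥ 0` with `U(1-δ)²/4 + 8κ + 4δ < (16/π²) sin²(π√(1-δ)/2)` and all large `L`, every such `ψ`
has `S ≤ m - κL²`).  At `κ → 0` the window is `U < U₀(δ) = 4[(16/π²) sin²(π√(1-δ)/2) - 4δ]/(1-δ)²`
(`U₀ ≈ 6.4, 6.0, 4.8, 2.5` at `δ = 0.02, 0.1, 0.2, 0.3`); inside it requirement R9 of Theorem 14
holds unconditionally and carries no information about the summit.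
Elementary (variational principle + bathtub + lattice trigonometry); no sorry. [this work]
-/

noncomputable section

namespace Summit.HubbardSuperconductivity.HubbardSuperconductivity.Theorems.WeakCouplingSpin

open Matrix Finset Real Literature.MathematicalPhysics.QuantumLattice
open Literature.MathematicalPhysics.QuantumLattice.LiebThm1
open Literature.Probability.LatticeModels
open scoped ComplexOrder

variable {L : ℕ} [NeZero L]

/-! ### The two variational inequalities -/

/-- **Sector bathtub with repulsion.** For `L ≥ 3`, `U ≥ 0`, a unit vector `ψ` in Lieb's sector
`(a, b)` and Fermi sets `F_a`, `F_b` of `a`, `b` lowest band levels: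
`Σ_{F_a} ε_L + Σ_{F_b} ε_L ≤ Re⟨ψ, H(U) ψ⟩` (Bloch occupations of each spin lie in `[0,1]` and
sum to `a`, `b`; `⟨ψ, Σ_x n_{x↑}n_{x↓} ψ⟩ ≥ 0`). Lieb–Loss Thm 1.14; Stoner (1938). [folklore] -/
theorem fermiSum_add_fermiSum_le_re_expect (hL : 3 ≤ L) {U : ℝ} (hU : 0 ≤ U) {a b : ℕ}
    {ψ : Fock (Orb (FermionTorus 2 L))} (hψ : IsInSector a b ψ) (h1 : star ψ ⬝ᵥ ψ = 1)
    (Fa : Finset (TorusSite 2 L)) (ea : ℝ) (hFac : Fa.card = a)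
    (hFa : ∀ k ∈ Fa, torusBand L k ≤ ea) (hFa' : ∀ k ∉ Fa, ea ≤ torusBand L k)
    (Fb : Finset (TorusSite 2 L)) (eb : ℝ) (hFbc : Fb.card = b)
    (hFb : ∀ k ∈ Fb, torusBand L k ≤ eb) (hFb' : ∀ k ∉ Fb, eb ≤ torusBand L k) :
    ∑ k ∈ Fa, torusBand L k + ∑ k ∈ Fb, torusBand L k ≤
      (star ψ ⬝ᵥ (hubbardTorus 2 L 1 U *ᵥ ψ)).re := by
  set x : TorusSite 2 L → ℝ := fun k => (star ψ ⬝ᵥ (momentumNumber k 0 *ᵥ ψ)).re with hx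
  have hx0 : ∀ k, 0 ≤ x k := fun k => (re_expect_momentumNumber_mem_Icc k 0 ψ).1
  have hx1 : ∀ k, x k ≤ 1 := fun k => by
    have := (re_expect_momentumNumber_mem_Icc k 0 ψ).2
    rwa [h1, Complex.one_re] at this
  have hz0 : ∀ k : TorusSite 2 L, 0 ≤ (star ψ ⬝ᵥ (momentumNumber (-k) 1 *ᵥ ψ)).re := fun k =>
    (re_expect_momentumNumber_mem_Icc (-k) 1 ψ).1
  have hz1 : ∀ k : TorusSite 2 L, (star ψ ⬝ᵥ (momentumNumber (-k) 1 *ᵥ ψ)).re ≤ 1 := fun k => by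
    have := (re_expect_momentumNumber_mem_Icc (-k) 1 ψ).2
    rwa [h1, Complex.one_re] at this
  have hxs : ∑ k, x k = Fa.card := by
    rw [hFac]
    have := sum_re_expect_momentumNumber_up (L := L) hψ
    rwa [h1, Complex.one_re, mul_one] at this
  have hzs : ∑ k : TorusSite 2 L, (star ψ ⬝ᵥ (momentumNumber (-k) 1 *ᵥ ψ)).re = Fb.card := by
    rw [hFbc]
    have := sum_re_expect_momentumNumber_down (L := L) hψ
    rw [h1, Complex.one_re, mul_one] at this
    rw [← this]
    exact Equiv.sum_comp (Equiv.neg (TorusSite 2 L))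
      (fun k => (star ψ ⬝ᵥ (momentumNumber k 1 *ᵥ ψ)).re)
  have hE : (star ψ ⬝ᵥ (hubbardTorus 2 L 1 0 *ᵥ ψ)).re =
      ∑ k, torusBand L k * x k + ∑ k : TorusSite 2 L, torusBand L k *
        (star ψ ⬝ᵥ (momentumNumber (-k) 1 *ᵥ ψ)).re := by
    rw [← hubbardTorusWith_zero, hubbardTorusWith_zero_eq_sum_pairBlock_kinetic hL 0, Matrix.sum_mulVec,
      dotProduct_sum, Complex.re_sum, ← Finset.sum_add_distrib]
    refine Finset.sum_congr rfl fun k _ => ?_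
    rw [Matrix.smul_mulVec, dotProduct_smul, smul_eq_mul, Complex.re_ofReal_mul, add_mulVec,
      dotProduct_add, Complex.add_re, sub_zero]
    ring
  have hbx := sum_fermiSet_le (torusBand L) x Fa ea hFa hFa' hx0 hx1 hxs
  have hbz := sum_fermiSet_le (torusBand L) (fun k => (star ψ ⬝ᵥ (momentumNumber (-k) 1 *ᵥ ψ)).re)
    Fb eb hFb hFb' hz0 hz1 hzs
  have hD := (re_expect_interaction_torus_mem_Icc ψ).1
  rw [hubbardTorus_eq_zero_add_smul_interaction U, add_mulVec, Matrix.smul_mulVec, dotProduct_add,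
    dotProduct_smul, smul_eq_mul, Complex.add_re, Complex.re_ofReal_mul, hE]
  nlinarith [mul_nonneg hU hD]

/-- **The paired Fermi sea bounds the `S^z = 0` floor**: for `L ≥ 3`, any real `U` and a Fermi set
`F`: `minEnergyOn H(U) (szSector (2|F|) 0) ≤ 2 Σ_F ε_L + U |F|²/L²`. Penn (1966) §II. [folklore] -/
theorem minEnergyOn_szSector_le_pairedFermiSea (hL : 3 ≤ L) (U : ℝ) (F : Finset (TorusSite 2 L))
    (eF : ℝ) (hF : ∀ k ∈ F, torusBand L k ≤ eF) (hF' : ∀ k ∉ F, eF ≤ torusBand L k) :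
    (hubbardTorus 2 L 1 U).minEnergyOn (szSector (Λ := FermionTorus 2 L) (2 * F.card) 0) ≤
      2 * ∑ k ∈ F, torusBand L k + U * ((F.card : ℝ) ^ 2 / (L : ℝ) ^ 2) := by
  classical
  have hH : (hubbardTorus 2 L 1 U).IsHermitian := hamiltonian_isHermitian _ 1 U
  have hmem : ((List.map (fun k : TorusSite 2 L => (pairMode k)ᴴ) F.toList).prod *ᵥ
      (vacuum : Fock (Orb (FermionTorus 2 L)))) ∈ szSector (Λ := FermionTorus 2 L) (2 * F.card) 0 := by
    rw [← F.length_toList]; exact pairedState_mem_szSector F.toList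
  have h := minEnergyOn_le_rayleigh_of_mem hH _ hmem (star_pairedState_dotProduct_self F.nodup_toList)
  rwa [re_expect_hubbardTorus_pairedFermiSea hL U F eF hF hF', minEnergyOn_szSector_free_eq hL F eF hF hF']
    at h

/-! ### Theorem 15a: the finite-volume minority bound -/

/-- **Theorem 15a (minority lower bound at finite volume).** For `L ≥ 3`, `U ≥ 0`, `S ≤ m`,
`2m ≤ L²`, `K` with `2K² + 2K + 1 ≤ m` and `2K + 1 ≤ L`, and every `ψ ≠ 0` in Lieb's sector
`(m + S, m - S)` with `H(U) ψ = E₀(U; 2m, S^z = 0) ψ`: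
`(16L²/π²) sin²(Kπ/L) · (L² - m)/(L² - (2K² + 2K + 1)) - 4(L² - 2m) - U m²/L² ≤ 8 (m - S)`.
(Stoner-type variational exclusion: bathtub below in the sector, diamond paired Fermi sea above.)
[this work] -/
theorem minority_lower_bound (hL : 3 ≤ L) {U : ℝ} (hU : 0 ≤ U) {m S K : ℕ} (hS : S ≤ m)
    (h2m : 2 * m ≤ L ^ 2) (hKm : 2 * K ^ 2 + 2 * K + 1 ≤ m) (hK : 2 * K + 1 ≤ L)
    {ψ : Fock (Orb (FermionTorus 2 L))} (h0 : ψ ≠ 0) (hψ : IsInSector (m + S) (m - S) ψ)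
    (hE : hubbardTorus 2 L 1 U *ᵥ ψ =
      (((hubbardTorus 2 L 1 U).minEnergyOn (szSector (Λ := FermionTorus 2 L) (2 * m) 0) : ℝ) : ℂ) • ψ) :
    16 * (L : ℝ) ^ 2 / π ^ 2 * Real.sin ((K : ℝ) * π / L) ^ 2 *
        (((L : ℝ) ^ 2 - m) / ((L : ℝ) ^ 2 - (2 * (K : ℝ) ^ 2 + 2 * K + 1))) -
      4 * ((L : ℝ) ^ 2 - 2 * m) - U * ((m : ℝ) ^ 2 / (L : ℝ) ^ 2) ≤ 8 * ((m : ℝ) - S) := by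
  classical
  -- normalise `ψ`
  have hpos : 0 < star ψ ⬝ᵥ ψ := dotProduct_star_self_pos_iff.2 h0
  have hposre : 0 < (star ψ ⬝ᵥ ψ).re := (Complex.pos_iff.1 hpos).1
  have him : (star ψ ⬝ᵥ ψ).im = 0 := by
    have := (Complex.pos_iff.1 hpos).2
    simpa using this.symm
  have hreal : star ψ ⬝ᵥ ψ = ((star ψ ⬝ᵥ ψ).re : ℂ) := Complex.ext (by simp) (by simp [him])
  set r : ℝ := Real.sqrt (star ψ ⬝ᵥ ψ).re with hr
  have hr0 : 0 < r := Real.sqrt_pos.2 hposre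
  have hr2 : r ^ 2 = (star ψ ⬝ᵥ ψ).re := Real.sq_sqrt hposre.le
  set φ := ((r⁻¹ : ℝ) : ℂ) • ψ with hφ
  have hφ1 : star φ ⬝ᵥ φ = 1 := by
    rw [hφ, star_smul, smul_dotProduct, dotProduct_smul, smul_smul, hreal, Complex.star_def,
      Complex.conj_ofReal, smul_eq_mul, ← hr2]
    push_cast
    field_simp
  have hφsec : IsInSector (m + S) (m - S) φ := isInSector_smul hψ _
  set E₀ : ℝ := (hubbardTorus 2 L 1 U).minEnergyOn (szSector (Λ := FermionTorus 2 L) (2 * m) 0) with hE₀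
  have hφE : (star φ ⬝ᵥ (hubbardTorus 2 L 1 U *ᵥ φ)).re = E₀ := by
    rw [hφ, mulVec_smul, hE, smul_comm, ← hφ, dotProduct_smul, smul_eq_mul, hφ1, mul_one,
      Complex.ofReal_re]
  -- Fermi sets for `m + S`, `m - S`, `m` levels
  have hcard : Fintype.card (TorusSite 2 L) = L ^ 2 := card_torusSite_two L
  obtain ⟨Fa, ea, hFac, hFa, hFa'⟩ :=
    exists_fermiSet (torusBand L) (n := m + S) (by rw [hcard]; omega)
  obtain ⟨Fb, eb, hFbc, hFb, hFb'⟩ :=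
    exists_fermiSet (torusBand L) (n := m - S) (by rw [hcard]; omega)
  obtain ⟨Fm, em, hFmc, hFm, hFm'⟩ :=
    exists_fermiSet (torusBand L) (n := m) (by rw [hcard]; omega)
  have hlow := fermiSum_add_fermiSum_le_re_expect hL hU hφsec hφ1 Fa ea hFac hFa hFa' Fb eb hFbc hFb hFb'
  have hup := minEnergyOn_szSector_le_pairedFermiSea hL U Fm em hFm hFm'
  rw [hFmc] at hup
  have ha := neg_four_mul_le_fermiSum (L := L) (by omega) Fa
  have hb := neg_four_mul_card_le_fermiSum (L := L) Fb
  have hdiam := fermiSum_le_of_diamond (L := L) (by omega) Fm em hFm hFm' (by rw [hFmc]; omega)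
    (by rw [hFmc]; exact hKm) hK
  rw [hFmc] at hdiam
  rw [hφE] at hlow
  have hca : (Fa.card : ℝ) = (m : ℝ) + S := by rw [hFac]; push_cast; ring
  have hcb : (Fb.card : ℝ) = (m : ℝ) - S := by rw [hFbc, Nat.cast_sub hS]
  rw [hca] at ha
  rw [hcb] at hb
  have hE₀le : E₀ ≤ 2 * ∑ k ∈ Fm, torusBand L k + U * ((m : ℝ) ^ 2 / (L : ℝ) ^ 2) := hup
  set X : ℝ := 16 * (L : ℝ) ^ 2 / π ^ 2 * Real.sin ((K : ℝ) * π / L) ^ 2 *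
      (((L : ℝ) ^ 2 - m) / ((L : ℝ) ^ 2 - (2 * (K : ℝ) ^ 2 + 2 * K + 1))) with hX
  have hd : 2 * ∑ k ∈ Fm, torusBand L k ≤ -X := by
    have e : -(8 * (L : ℝ) ^ 2 / π ^ 2 * Real.sin ((K : ℝ) * π / L) ^ 2) *
        (((L : ℝ) ^ 2 - m) / ((L : ℝ) ^ 2 - (2 * (K : ℝ) ^ 2 + 2 * K + 1))) = -(1 / 2) * X := by
      rw [hX]; ring
    rw [e] at hdiam
    linarith only [hdiam]
  linarith only [hlow, ha, hb, hd, hE₀le]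

/-! ### Theorem 15: the weak-coupling window -/

/-- **Theorem 15 (requirement R9 holds outright at weak coupling).** Let `0 < δ < 1`, `κ ∈ ℝ`,
`U ≥ 0` with `U(1-δ)²/4 + 8κ + 4δ < (16/π²) sin²(π√(1-δ)/2)`. Then there is `L₀` such that for
every `L = n + 1 ≥ L₀`, with `m = ⌊(1-δ)L²/2⌋`: every `ψ ≠ 0` in Lieb's sector `(m + S, m - S)`,
`S ≤ m`, with `H(U)ψ = E₀(U; 2m, S^z = 0) ψ` — in particular every member of a ground multiplet
of the `(N = 2m, S^z = 0)` sector, of total spin `S` — satisfies `S ≤ m - κ L²`.  (No evenness of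
`L` and no highest-weight condition are needed.)  Stoner-type bound; compare Theorem 14, where
the same conclusion with `κ = c/32` is derived from the summit statement for its own `U, δ`.
[this work] -/
theorem weakCoupling_excludes_near_saturated_ferromagnetism {δ κ U : ℝ} (hδ0 : 0 < δ) (hδ1 : δ < 1)
    (hU : 0 ≤ U)
    (hgap : U * (1 - δ) ^ 2 / 4 + 8 * κ + 4 * δ <
      16 / π ^ 2 * Real.sin (π * Real.sqrt (1 - δ) / 2) ^ 2) :
    ∃ L₀ : ℕ, ∀ n : ℕ, L₀ ≤ n + 1 →
      ∀ S : ℕ, S ≤ ⌊(1 - δ) * ((n + 1 : ℕ) : ℝ) ^ 2 / 2⌋₊ →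
        ∀ ψ : Fock (Orb (FermionTorus 2 (n + 1))), ψ ≠ 0 →
          IsInSector (⌊(1 - δ) * ((n + 1 : ℕ) : ℝ) ^ 2 / 2⌋₊ + S)
            (⌊(1 - δ) * ((n + 1 : ℕ) : ℝ) ^ 2 / 2⌋₊ - S) ψ →
          hubbardTorus 2 (n + 1) 1 U *ᵥ ψ =
            (((hubbardTorus 2 (n + 1) 1 U).minEnergyOn
                (szSector (2 * ⌊(1 - δ) * ((n + 1 : ℕ) : ℝ) ^ 2 / 2⌋₊) 0) : ℝ) : ℂ) • ψ →
            (S : ℝ) ≤ ⌊(1 - δ) * ((n + 1 : ℕ) : ℝ) ^ 2 / 2⌋₊ - κ * ((n + 1 : ℕ) : ℝ) ^ 2 := by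
  set s : ℝ := Real.sin (π * Real.sqrt (1 - δ) / 2) with hs
  set room : ℝ := 16 / π ^ 2 * s ^ 2 - 4 * δ - U * (1 - δ) ^ 2 / 4 - 8 * κ with hroom
  have hroom0 : 0 < room := by rw [hroom]; linarith
  set C : ℝ := 16 / π ^ 2 * (4 * π + 6) with hC
  have hC0 : 0 ≤ C := by rw [hC]; positivity
  refine ⟨max (max 6 (⌈4 / (1 - δ)⌉₊ + 2)) (⌈(C + 8) / room⌉₊ + 1), ?_⟩
  intro n hn S hS ψ h0 hψ hE
  set Lr : ℝ := ((n + 1 : ℕ) : ℝ) with hLr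
  set m : ℕ := ⌊(1 - δ) * Lr ^ 2 / 2⌋₊ with hm
  have hL6 : 6 ≤ n + 1 := le_trans (le_max_left _ _ |>.trans' (le_max_left _ _)) hn
  have hLr1 : (1 : ℝ) ≤ Lr := by rw [hLr]; exact_mod_cast Nat.succ_le_succ (Nat.zero_le n)
  have hLr6 : (6 : ℝ) ≤ Lr := by rw [hLr]; exact_mod_cast hL6
  have hLrpos : (0 : ℝ) < Lr := by linarith only [hLr1]
  have h1δ : 0 < 1 - δ := by linarith only [hδ1]
  -- size of `m`
  have harg : 0 ≤ (1 - δ) * Lr ^ 2 / 2 := by positivity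
  have hm_le : (m : ℝ) ≤ (1 - δ) * Lr ^ 2 / 2 := Nat.floor_le harg
  have hm_gt : (1 - δ) * Lr ^ 2 / 2 < m + 1 := Nat.lt_floor_add_one _
  have hLδ : 4 / (1 - δ) ≤ Lr := by
    have h1 : ⌈4 / (1 - δ)⌉₊ + 2 ≤ n + 1 := le_trans (le_max_right _ _ |>.trans (le_max_left _ _)) hn
    have h2 : (4 / (1 - δ) : ℝ) ≤ ⌈4 / (1 - δ)⌉₊ := Nat.le_ceil _
    have h3 : ((⌈4 / (1 - δ)⌉₊ : ℕ) : ℝ) + 2 ≤ Lr := by rw [hLr]; exact_mod_cast h1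
    linarith only [h2, h3]
  have hm1 : 1 ≤ m := by
    have h4 : 4 ≤ (1 - δ) * Lr := by rwa [div_le_iff₀ h1δ, mul_comm] at hLδ
    have h5 : 4 * 1 ≤ (1 - δ) * Lr * Lr := mul_le_mul h4 hLr1 zero_le_one (by positivity)
    have h6 : (2 : ℝ) ≤ (1 - δ) * Lr ^ 2 / 2 := by rw [sq]; linarith only [h5]
    have h7 : (0 : ℝ) < m := by linarith only [h6, hm_gt]
    exact_mod_cast h7
  have hδL : 0 ≤ δ * Lr ^ 2 := mul_nonneg hδ0.le (sq_nonneg Lr)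
  have h2m_real : 2 * (m : ℝ) ≤ Lr ^ 2 := by linarith only [hm_le, hδL]
  have h2m : 2 * m ≤ (n + 1) ^ 2 := by
    have h : (2 : ℝ) * m ≤ ((n : ℝ) + 1) ^ 2 := by
      have h' := h2m_real
      rw [hLr] at h'
      push_cast at h'
      exact h'
    exact_mod_cast h
  -- the diamond size `K = ⌊√(m/2)⌋ - 1`
  set q : ℕ := Nat.sqrt (m / 2) with hq
  set K : ℕ := q - 1 with hK
  have hsq : q * q ≤ m / 2 := Nat.sqrt_le (m / 2)
  have hsq' : m / 2 < (q + 1) * (q + 1) := Nat.lt_succ_sqrt (m / 2)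
  have hdiv : 2 * (m / 2) ≤ m := Nat.mul_div_le m 2
  have hdiv' : m ≤ 2 * (m / 2) + 1 := by omega
  have h2q : 2 * q ≤ n + 1 := by
    have h' : (2 * q) * (2 * q) ≤ (n + 1) * (n + 1) := by
      have := h2m; rw [sq] at this; nlinarith [hsq, hdiv]
    exact Nat.mul_self_le_mul_self_iff.1 h'
  have hK_L : 2 * K + 1 ≤ n + 1 := by omega
  have hK_m : 2 * K ^ 2 + 2 * K + 1 ≤ m := by
    rcases Nat.eq_zero_or_pos q with hq0 | hq0
    · have : K = 0 := by omega
      rw [this]; simpa using hm1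
    · have hKq : K + 1 = q := by omega
      have hsqK : (K + 1) * (K + 1) ≤ m / 2 := by rw [hKq]; exact hsq
      have h2' : 2 * ((K + 1) * (K + 1)) ≤ m := le_trans (Nat.mul_le_mul_left 2 hsqK) hdiv
      nlinarith [h2']
  have hr_nat : m ≤ 2 * K ^ 2 + 2 * K + 1 + 3 * (n + 1) := by
    rcases Nat.eq_zero_or_pos q with hq0 | hq0
    · have hK0 : K = 0 := by omega
      rw [hq0] at hsq'
      rw [hK0]
      omega
    · have hKq : K + 1 = q := by omega
      have hsqK : m / 2 < (K + 1 + 1) * (K + 1 + 1) := by rw [hKq]; exact hsq'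
      have h2qK : 2 * (K + 1) ≤ n + 1 := by rw [hKq]; exact h2q
      nlinarith [hsqK, h2qK, hdiv']
  -- real-variable bounds on `K`
  have hKr_le : (K : ℝ) ≤ Lr * Real.sqrt (1 - δ) / 2 := by
    have hq_le : (q : ℝ) ≤ Lr * Real.sqrt (1 - δ) / 2 := by
      have h1 : ((q : ℝ)) ^ 2 ≤ (1 - δ) * Lr ^ 2 / 4 := by
        have h0' : ((q * q : ℕ) : ℝ) ≤ ((m / 2 : ℕ) : ℝ) := by exact_mod_cast hsq
        have h2 : ((m / 2 : ℕ) : ℝ) ≤ (m : ℝ) / 2 := Nat.cast_div_le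
        push_cast at h0'
        rw [sq]
        linarith only [h0', h2, hm_le]
      have h3 : Real.sqrt ((q : ℝ) ^ 2) ≤ Real.sqrt ((Lr * Real.sqrt (1 - δ) / 2) ^ 2) := by
        refine Real.sqrt_le_sqrt ?_
        rw [div_pow, mul_pow, Real.sq_sqrt h1δ.le]
        linarith only [h1]
      rw [Real.sqrt_sq (Nat.cast_nonneg q), Real.sqrt_sq (by positivity)] at h3
      exact h3
    have hKq' : (K : ℝ) ≤ q := by exact_mod_cast (show K ≤ q by omega)
    linarith only [hKq', hq_le]
  have hKr_ge : Lr * Real.sqrt (1 - δ) / 2 - 2 ≤ K := by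
    have hq_ge : Lr * Real.sqrt (1 - δ) / 2 ≤ (q : ℝ) + 1 := by
      have h1 : (1 - δ) * Lr ^ 2 / 4 ≤ ((q : ℝ) + 1) ^ 2 := by
        have h0' : ((m / 2 : ℕ) : ℝ) + 1 ≤ (((q + 1) * (q + 1) : ℕ) : ℝ) := by exact_mod_cast hsq'
        have h2 : (m : ℝ) ≤ 2 * ((m / 2 : ℕ) : ℝ) + 1 := by exact_mod_cast hdiv'
        push_cast at h0'
        rw [sq]
        linarith only [h0', h2, hm_gt]
      have h3 : Real.sqrt ((Lr * Real.sqrt (1 - δ) / 2) ^ 2) ≤ Real.sqrt (((q : ℝ) + 1) ^ 2) := by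
        refine Real.sqrt_le_sqrt ?_
        rw [div_pow, mul_pow, Real.sq_sqrt h1δ.le]
        linarith only [h1]
      rw [Real.sqrt_sq (by positivity), Real.sqrt_sq (by positivity)] at h3
      exact h3
    have hqK : (q : ℝ) - 1 ≤ K := by
      have h' : q ≤ K + 1 := by omega
      have h'' : (q : ℝ) ≤ (K : ℝ) + 1 := by exact_mod_cast h'
      linarith only [h'']
    linarith only [hqK, hq_ge]
  -- `sin²(Kπ/L) ≥ s² - 4π/L`
  have hsin : s ^ 2 - 4 * π / Lr ≤ Real.sin ((K : ℝ) * π / Lr) ^ 2 := by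
    have h := sin_sq_sub_sin_sq_le ((K : ℝ) * π / Lr) (π * Real.sqrt (1 - δ) / 2)
    have hdiff : |(K : ℝ) * π / Lr - π * Real.sqrt (1 - δ) / 2| ≤ 2 * π / Lr := by
      rw [abs_le]
      constructor
      · have : (Lr * Real.sqrt (1 - δ) / 2 - 2) * π / Lr ≤ (K : ℝ) * π / Lr :=
          div_le_div_of_nonneg_right (mul_le_mul_of_nonneg_right hKr_ge pi_pos.le) hLrpos.le
        have e : (Lr * Real.sqrt (1 - δ) / 2 - 2) * π / Lr = π * Real.sqrt (1 - δ) / 2 - 2 * π / Lr := by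
          field_simp
        linarith only [this, e]
      · have h' : (K : ℝ) * π / Lr ≤ (Lr * Real.sqrt (1 - δ) / 2) * π / Lr :=
          div_le_div_of_nonneg_right (mul_le_mul_of_nonneg_right hKr_le pi_pos.le) hLrpos.le
        have e : (Lr * Real.sqrt (1 - δ) / 2) * π / Lr = π * Real.sqrt (1 - δ) / 2 := by
          field_simp
        have h'' : 0 ≤ 2 * π / Lr := by positivity
        linarith only [h', e, h'']
    rw [← hs] at h
    have e4 : 4 * π / Lr = 2 * (2 * π / Lr) := by ring
    linarith only [h, hdiff, e4]
  -- the dilution factor `f ≥ 1 - 6/L`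
  have hNu : Lr ^ 2 / 2 ≤ Lr ^ 2 - m := by linarith only [hm_le, hδL]
  have hL2pos : (0 : ℝ) < Lr ^ 2 := pow_pos hLrpos 2
  have hDpos : 0 < Lr ^ 2 - (2 * (K : ℝ) ^ 2 + 2 * K + 1) := by
    have h' : (2 * (K : ℝ) ^ 2 + 2 * K + 1) ≤ m := by exact_mod_cast hK_m
    linarith only [h', hNu, hL2pos]
  have hDle : Lr ^ 2 - (2 * (K : ℝ) ^ 2 + 2 * K + 1) ≤ Lr ^ 2 - m + 3 * Lr := by
    have h' : (m : ℝ) ≤ 2 * (K : ℝ) ^ 2 + 2 * K + 1 + 3 * Lr := by rw [hLr]; exact_mod_cast hr_nat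
    linarith only [h']
  have hf : 1 - 6 / Lr ≤ (Lr ^ 2 - m) / (Lr ^ 2 - (2 * (K : ℝ) ^ 2 + 2 * K + 1)) := by
    rw [le_div_iff₀ hDpos]
    have h16 : 0 ≤ 1 - 6 / Lr := by
      rw [sub_nonneg, div_le_one hLrpos]; exact hLr6
    have step1 : (1 - 6 / Lr) * (Lr ^ 2 - (2 * (K : ℝ) ^ 2 + 2 * K + 1)) ≤
        (1 - 6 / Lr) * (Lr ^ 2 - m + 3 * Lr) := mul_le_mul_of_nonneg_left hDle h16
    have step2 : (1 - 6 / Lr) * (Lr ^ 2 - m + 3 * Lr) =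
        Lr ^ 2 - m + 3 * Lr - 6 * (Lr ^ 2 - m) / Lr - 18 := by field_simp; ring
    have step3 : 3 * Lr ≤ 6 * (Lr ^ 2 - m) / Lr := by
      rw [le_div_iff₀ hLrpos]; linarith only [hNu]
    linarith only [step1, step2, step3]
  -- assemble the main term
  have hsin0 : 0 ≤ Real.sin ((K : ℝ) * π / Lr) ^ 2 := sq_nonneg _
  have h16 : 0 ≤ 1 - 6 / Lr := by rw [sub_nonneg, div_le_one hLrpos]; exact hLr6
  have hT1 : 16 / π ^ 2 * (s ^ 2 * Lr ^ 2 - (4 * π + 6) * Lr) ≤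
      16 * Lr ^ 2 / π ^ 2 * Real.sin ((K : ℝ) * π / Lr) ^ 2 *
        ((Lr ^ 2 - m) / (Lr ^ 2 - (2 * (K : ℝ) ^ 2 + 2 * K + 1))) := by
    have hprod : (s ^ 2 - 4 * π / Lr) * (1 - 6 / Lr) ≤
        Real.sin ((K : ℝ) * π / Lr) ^ 2 * ((Lr ^ 2 - m) / (Lr ^ 2 - (2 * (K : ℝ) ^ 2 + 2 * K + 1))) :=
      calc (s ^ 2 - 4 * π / Lr) * (1 - 6 / Lr) ≤ Real.sin ((K : ℝ) * π / Lr) ^ 2 * (1 - 6 / Lr) :=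
            mul_le_mul_of_nonneg_right hsin h16
        _ ≤ _ := mul_le_mul_of_nonneg_left hf hsin0
    have hs1 : s ^ 2 ≤ 1 := by rw [hs]; exact Real.sin_sq_le_one _
    have hexp : s ^ 2 * Lr ^ 2 - (4 * π + 6) * Lr ≤ Lr ^ 2 * ((s ^ 2 - 4 * π / Lr) * (1 - 6 / Lr)) := by
      have e : Lr ^ 2 * ((s ^ 2 - 4 * π / Lr) * (1 - 6 / Lr)) =
          s ^ 2 * Lr ^ 2 - 4 * π * Lr - 6 * s ^ 2 * Lr + 24 * π := by field_simp; ring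
      have h6 : s ^ 2 * Lr ≤ 1 * Lr := mul_le_mul_of_nonneg_right hs1 hLrpos.le
      rw [e]; linarith only [h6, pi_pos]
    have hπ : 0 ≤ 16 / π ^ 2 := by positivity
    calc 16 / π ^ 2 * (s ^ 2 * Lr ^ 2 - (4 * π + 6) * Lr)
        ≤ 16 / π ^ 2 * (Lr ^ 2 * ((s ^ 2 - 4 * π / Lr) * (1 - 6 / Lr))) := mul_le_mul_of_nonneg_left hexp hπ
      _ = 16 * Lr ^ 2 / π ^ 2 * ((s ^ 2 - 4 * π / Lr) * (1 - 6 / Lr)) := by ring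
      _ ≤ _ := by
          rw [mul_assoc (16 * Lr ^ 2 / π ^ 2)]
          exact mul_le_mul_of_nonneg_left hprod (by positivity)
  have hT2 : 4 * (Lr ^ 2 - 2 * m) ≤ 4 * δ * Lr ^ 2 + 8 := by linarith only [hm_gt]
  have hT3 : U * ((m : ℝ) ^ 2 / Lr ^ 2) ≤ U * (1 - δ) ^ 2 * Lr ^ 2 / 4 := by
    have hm0 : (0 : ℝ) ≤ m := Nat.cast_nonneg m
    have h1 : (m : ℝ) ^ 2 ≤ ((1 - δ) * Lr ^ 2 / 2) ^ 2 := pow_le_pow_left₀ hm0 hm_le 2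
    have hL2 : (0 : ℝ) < Lr ^ 2 := by positivity
    have h2 : (m : ℝ) ^ 2 / Lr ^ 2 ≤ (1 - δ) ^ 2 * Lr ^ 2 / 4 := by
      rw [div_le_iff₀ hL2]
      have e : ((1 - δ) * Lr ^ 2 / 2) ^ 2 = (1 - δ) ^ 2 * Lr ^ 2 / 4 * Lr ^ 2 := by ring
      rw [← e]; exact h1
    calc U * ((m : ℝ) ^ 2 / Lr ^ 2) ≤ U * ((1 - δ) ^ 2 * Lr ^ 2 / 4) := mul_le_mul_of_nonneg_left h2 hU
      _ = U * (1 - δ) ^ 2 * Lr ^ 2 / 4 := by ring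
  -- the room beats the linear error
  have hLroom : (C + 8) / room ≤ Lr := by
    have h1 : ⌈(C + 8) / room⌉₊ + 1 ≤ n + 1 := le_trans (le_max_right _ _) hn
    have h2 : ((C + 8) / room : ℝ) ≤ ⌈(C + 8) / room⌉₊ := Nat.le_ceil _
    have h3 : ((⌈(C + 8) / room⌉₊ : ℕ) : ℝ) + 1 ≤ Lr := by rw [hLr]; exact_mod_cast h1
    linarith only [h2, h3]
  have herr : C * Lr + 8 ≤ room * Lr ^ 2 := by
    have h1 : C + 8 ≤ room * Lr := by rwa [div_le_iff₀' hroom0] at hLroom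
    have h2 : (C + 8) * Lr ≤ room * Lr * Lr := mul_le_mul_of_nonneg_right h1 hLrpos.le
    rw [sq, ← mul_assoc]
    nlinarith only [h2, hLr1, hC0]
  have hCL : 16 / π ^ 2 * ((4 * π + 6) * Lr) = C * Lr := by rw [hC]; ring
  -- Theorem 15a at this `K`, and conclude
  have hmain := minority_lower_bound (L := n + 1) (by omega) hU hS h2m hK_m hK_L h0 hψ hE
  rw [← hLr] at hmain
  have key : 8 * κ * Lr ^ 2 ≤ 8 * ((m : ℝ) - S) := by
    have e1 : 16 / π ^ 2 * (s ^ 2 * Lr ^ 2 - (4 * π + 6) * Lr) = 16 / π ^ 2 * s ^ 2 * Lr ^ 2 - C * Lr := by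
      rw [← hCL]; ring
    have hroom' : room * Lr ^ 2 = 16 / π ^ 2 * s ^ 2 * Lr ^ 2 - 4 * δ * Lr ^ 2 -
        U * (1 - δ) ^ 2 * Lr ^ 2 / 4 - 8 * κ * Lr ^ 2 := by rw [hroom]; ring
    linarith only [hmain, hT1, hT2, hT3, herr, e1, hroom']
  linarith only [key]

end Summit.HubbardSuperconductivity.HubbardSuperconductivity.Theorems.WeakCouplingSpin
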